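import Mathlib
import HarnessLib

/-!
# Dihedral reflection of cubical atoms, I: partial products and the reflected point

Groundwork for crux `DihedralNormalForm` (stmt-KontsevichZagierPeriods-3912), line
`torus-descent-sum-shadow`, stub `stub_nonSimpleReduction`: the analysis of that stub shows that
non-simply-directed atoms need Brown's DIHEDRAL symmetries of `M_{0,k+3}` read in the cubical chart
`tᵢ = x₀⋯xᵢ`. This file and its two sequels prove the basic one, the reflection
`S = C⁻¹ ∘ (t ↦ 𝟙 - t^{rev}) ∘ C`, as a KZ relation between cubical atoms
`[□ᵏ, q·xᵃ·∏_{i≤j}(1 - x_i⋯x_j)^{e i j}]` with explicitly transformed exponents.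

No new definitions are introduced: the partial products `T m x = x₀⋯x_{m-1}`, the interval
products `I i j x = x_i⋯x_j`, the `q`-free atom integrand `A a e x` and the index involution `τ`
(`τ 0 = 0`, `τ m = k - m`) are VARIABLES constrained by defining hypotheses (`hT`, `hI`, `hA`,
`hτ0`, `hτ1`), instantiated by the corresponding lambda terms in part III.

Here: the `T`'s, `log A` on the open cube, `τ`, the Jacobian `∏ xⱼ^{k-1-j} = ∏_{i ≠ 0} T i x`, and
the reflected point `z` (characterised by `T m z = 1 - T (k+1-m) y`) in terms of `y`. -/

noncomputable section

open Finset Real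

namespace Summit.KontsevichZagierPeriods.DihedralNormalForm.TorusDescent

variable {k : ℕ}
variable (T : ℕ → (Fin k → ℝ) → ℝ) (I : Fin k → Fin k → (Fin k → ℝ) → ℝ)
  (A : (Fin k → ℕ) → (Fin k → Fin k → ℤ) → (Fin k → ℝ) → ℝ) (τ : Fin k → Fin k)

/-! ### Partial products -/

/-- `T 0 x = 1`. -/
theorem T_zero (hT : ∀ (m : ℕ) (x : Fin k → ℝ), T m x = ∏ j : Fin k, if (j : ℕ) < m then x j else 1)
    (x : Fin k → ℝ) : T 0 x = 1 := by simp [hT]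

/-- `T (m+1) x = T m x · x_m` (`x_m = 1` beyond the dimension). -/
theorem T_succ (hT : ∀ (m : ℕ) (x : Fin k → ℝ), T m x = ∏ j : Fin k, if (j : ℕ) < m then x j else 1)
    (x : Fin k → ℝ) (m : ℕ) :
    T (m + 1) x = T m x * (if h : m < k then x ⟨m, h⟩ else 1) := by
  rw [hT, hT]
  have hsplit : ∀ j : Fin k, (if (j : ℕ) < m + 1 then x j else 1) =
      (if (j : ℕ) < m then x j else 1) * (if (j : ℕ) = m then x j else 1) := by
    intro j
    by_cases h1 : (j : ℕ) < m
    · rw [if_pos (by omega), if_pos h1, if_neg (by omega), mul_one]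
    · by_cases h2 : (j : ℕ) = m
      · rw [if_pos (by omega), if_neg h1, if_pos h2, one_mul]
      · rw [if_neg (by omega), if_neg h1, if_neg h2, one_mul]
  rw [Finset.prod_congr rfl fun j _ => hsplit j, Finset.prod_mul_distrib]
  congr 1
  by_cases h : m < k
  · rw [dif_pos h]
    have : ∀ j : Fin k, ((j : ℕ) = m) = (j = ⟨m, h⟩) := fun j => by rw [Fin.ext_iff]
    simp_rw [this]
    rw [Finset.prod_ite_eq']
    simp
  · rw [dif_neg h]
    refine Finset.prod_eq_one fun j _ => ?_
    rw [if_neg]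
    intro hj
    exact h (hj ▸ j.isLt)

/-- `T (j+1) x = T i x · I i j x` for `i ≤ j`: a partial product splits at `i`. -/
theorem T_succ_eq_mul_I
    (hT : ∀ (m : ℕ) (x : Fin k → ℝ), T m x = ∏ j : Fin k, if (j : ℕ) < m then x j else 1)
    (hI : ∀ (i j : Fin k) (x : Fin k → ℝ), I i j x = ∏ l : Fin k, if i ≤ l ∧ l ≤ j then x l else 1)
    (x : Fin k → ℝ) {i j : Fin k} (hij : i ≤ j) :
    T ((j : ℕ) + 1) x = T i x * I i j x := by
  rw [hT, hT, hI, ← Finset.prod_mul_distrib]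
  refine Finset.prod_congr rfl fun l _ => ?_
  have hij' : (i : ℕ) ≤ j := hij
  by_cases h1 : (l : ℕ) < i
  · have h2 : ¬(i ≤ l ∧ l ≤ j) := fun h => absurd (Fin.le_def.mp h.1) (by omega)
    rw [if_pos (by omega), if_pos h1, if_neg h2, mul_one]
  · rw [if_neg h1, one_mul]
    by_cases h3 : (l : ℕ) ≤ j
    · rw [if_pos (by omega), if_pos ⟨Fin.le_def.mpr (by omega), Fin.le_def.mpr h3⟩]
    · have h4 : ¬(i ≤ l ∧ l ≤ j) := fun h => absurd (Fin.le_def.mp h.2) h3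
      rw [if_neg (by omega), if_neg h4]

/-- `T (i+1) x = T i x · x_i`. -/
theorem T_succ_eq_mul
    (hT : ∀ (m : ℕ) (x : Fin k → ℝ), T m x = ∏ j : Fin k, if (j : ℕ) < m then x j else 1)
    (x : Fin k → ℝ) (i : Fin k) : T ((i : ℕ) + 1) x = T i x * x i := by
  rw [T_succ T hT, dif_pos i.isLt]

/-- On the open cube `0 < T m x`. -/
theorem T_pos (hT : ∀ (m : ℕ) (x : Fin k → ℝ), T m x = ∏ j : Fin k, if (j : ℕ) < m then x j else 1)
    {x : Fin k → ℝ} (hx : ∀ i, x i ∈ Set.Ioo (0 : ℝ) 1) (m : ℕ) : 0 < T m x := by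
  rw [hT]
  refine Finset.prod_pos fun j _ => ?_
  split_ifs
  · exact (hx j).1
  · exact one_pos

/-- On the open cube `T m x < 1` as soon as `1 ≤ m` and `1 ≤ k`. -/
theorem T_lt_one (hT : ∀ (m : ℕ) (x : Fin k → ℝ), T m x = ∏ j : Fin k, if (j : ℕ) < m then x j else 1)
    {x : Fin k → ℝ} (hx : ∀ i, x i ∈ Set.Ioo (0 : ℝ) 1) {m : ℕ} (hm : 1 ≤ m) (hk : 1 ≤ k) :
    T m x < 1 := by
  obtain ⟨m, rfl⟩ : ∃ m', m = m' + 1 := ⟨m - 1, by omega⟩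
  induction m with
  | zero =>
    rw [T_succ T hT, T_zero T hT, one_mul, dif_pos (by omega)]
    exact (hx _).2
  | succ m ih =>
    rw [T_succ T hT]
    have h0 := T_pos T hT hx (m + 1)
    split_ifs with h
    · calc T (m + 1) x * x ⟨m + 1, h⟩ < T (m + 1) x * 1 :=
            mul_lt_mul_of_pos_left (hx _).2 h0
        _ < 1 := by rw [mul_one]; exact ih (by omega)
    · rw [mul_one]; exact ih (by omega)

/-- On the open cube `I i j x < 1` for `i ≤ j`. -/
theorem I_lt_one
    (hI : ∀ (i j : Fin k) (x : Fin k → ℝ), I i j x = ∏ l : Fin k, if i ≤ l ∧ l ≤ j then x l else 1)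
    {x : Fin k → ℝ} (hx : ∀ i, x i ∈ Set.Ioo (0 : ℝ) 1) {i j : Fin k} (hij : i ≤ j) :
    I i j x < 1 := by
  rw [hI]
  calc (∏ l : Fin k, if i ≤ l ∧ l ≤ j then x l else 1)
      ≤ ∏ l : Fin k, (if l = j then x l else 1) := by
        refine Finset.prod_le_prod (fun l _ => ?_) fun l _ => ?_
        · split_ifs
          · exact (hx l).1.le
          · exact zero_le_one
        · by_cases hl : l = j
          · subst hl
            rw [if_pos ⟨hij, le_rfl⟩, if_pos rfl]
          · rw [if_neg hl]
            split_ifs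
            · exact (hx l).2.le
            · exact le_rfl
    _ = x j := by rw [Finset.prod_ite_eq']; simp
    _ < 1 := (hx j).2

/-- On the open cube the `q`-free atom integrand is positive. -/
theorem A_pos
    (hI : ∀ (i j : Fin k) (x : Fin k → ℝ), I i j x = ∏ l : Fin k, if i ≤ l ∧ l ≤ j then x l else 1)
    (hA : ∀ (a : Fin k → ℕ) (e : Fin k → Fin k → ℤ) (x : Fin k → ℝ), A a e x =
      (∏ i : Fin k, x i ^ a i) * ∏ i : Fin k, ∏ j : Fin k, if i ≤ j then (1 - I i j x) ^ e i j else 1)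
    {x : Fin k → ℝ} (hx : ∀ i, x i ∈ Set.Ioo (0 : ℝ) 1) (a : Fin k → ℕ) (e : Fin k → Fin k → ℤ) :
    0 < A a e x := by
  rw [hA]
  refine mul_pos (Finset.prod_pos fun i _ => pow_pos (hx i).1 _)
    (Finset.prod_pos fun i _ => Finset.prod_pos fun j _ => ?_)
  split_ifs with hij
  · exact zpow_pos (sub_pos.mpr (I_lt_one I hI hx hij)) _
  · exact one_pos

/-- Logarithm of the `q`-free atom integrand on the open cube:
`log A = Σ aᵢ log xᵢ + Σ_{i ≤ j} e i j · log (1 - x_i⋯x_j)`. -/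
theorem log_A
    (hI : ∀ (i j : Fin k) (x : Fin k → ℝ), I i j x = ∏ l : Fin k, if i ≤ l ∧ l ≤ j then x l else 1)
    (hA : ∀ (a : Fin k → ℕ) (e : Fin k → Fin k → ℤ) (x : Fin k → ℝ), A a e x =
      (∏ i : Fin k, x i ^ a i) * ∏ i : Fin k, ∏ j : Fin k, if i ≤ j then (1 - I i j x) ^ e i j else 1)
    {x : Fin k → ℝ} (hx : ∀ i, x i ∈ Set.Ioo (0 : ℝ) 1) (a : Fin k → ℕ) (e : Fin k → Fin k → ℤ) :
    Real.log (A a e x) = (∑ i : Fin k, (a i : ℝ) * Real.log (x i)) +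
      ∑ i : Fin k, ∑ j : Fin k, if i ≤ j then (e i j : ℝ) * Real.log (1 - I i j x) else 0 := by
  rw [hA]
  have hpow : ∀ i : Fin k, x i ^ a i ≠ 0 := fun i => pow_ne_zero _ (hx i).1.ne'
  have hfac : ∀ i j : Fin k, (if i ≤ j then (1 - I i j x) ^ e i j else (1 : ℝ)) ≠ 0 := by
    intro i j
    split_ifs with hij
    · exact zpow_ne_zero _ (sub_pos.mpr (I_lt_one I hI hx hij)).ne'
    · exact one_ne_zero
  rw [Real.log_mul (Finset.prod_ne_zero_iff.mpr fun i _ => hpow i)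
      (Finset.prod_ne_zero_iff.mpr fun i _ => Finset.prod_ne_zero_iff.mpr fun j _ => hfac i j),
    Real.log_prod (fun i _ => hpow i), Real.log_prod (fun i _ =>
      Finset.prod_ne_zero_iff.mpr fun j _ => hfac i j)]
  congr 1
  · exact Finset.sum_congr rfl fun i _ => Real.log_pow _ _
  · refine Finset.sum_congr rfl fun i _ => ?_
    rw [Real.log_prod (fun j _ => hfac i j)]
    refine Finset.sum_congr rfl fun j _ => ?_
    split_ifs with hij
    · exact Real.log_zpow _ _
    · exact Real.log_one

/-- `log T m x = Σ_{l < m} log x_l` on the open cube. -/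
theorem log_T (hT : ∀ (m : ℕ) (x : Fin k → ℝ), T m x = ∏ j : Fin k, if (j : ℕ) < m then x j else 1)
    {x : Fin k → ℝ} (hx : ∀ i, x i ∈ Set.Ioo (0 : ℝ) 1) (m : ℕ) :
    Real.log (T m x) = ∑ l : Fin k, if (l : ℕ) < m then Real.log (x l) else 0 := by
  rw [hT, Real.log_prod]
  · refine Finset.sum_congr rfl fun l _ => ?_
    split_ifs
    · rfl
    · exact Real.log_one
  · intro l _
    split_ifs
    · exact (hx l).1.ne'
    · exact one_ne_zero

/-- Prefix chords: `I i j x = T (j+1) x` when `i` has value `0`. -/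
theorem I_eq_T_of_zero
    (hT : ∀ (m : ℕ) (x : Fin k → ℝ), T m x = ∏ j : Fin k, if (j : ℕ) < m then x j else 1)
    (hI : ∀ (i j : Fin k) (x : Fin k → ℝ), I i j x = ∏ l : Fin k, if i ≤ l ∧ l ≤ j then x l else 1)
    (x : Fin k → ℝ) {i j : Fin k} (hi : (i : ℕ) = 0) : I i j x = T ((j : ℕ) + 1) x := by
  have hij : i ≤ j := Fin.le_def.mpr (by rw [hi]; exact Nat.zero_le _)
  have h1 := T_succ_eq_mul_I T I hT hI x hij
  have h0 : T (i : ℕ) x = 1 := by rw [hi, T_zero T hT]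
  rw [h1, h0, one_mul]

/-! ### The index involution `τ` (`τ 0 = 0`, `τ m = k - m` for `m ≠ 0`) -/

/-- `τ m` is non-zero iff `m` is. -/
theorem τ_ne_iff (hτ0 : ∀ m : Fin k, (m : ℕ) = 0 → τ m = m)
    (hτ1 : ∀ m : Fin k, (m : ℕ) ≠ 0 → ((τ m : Fin k) : ℕ) = k - m) (m : Fin k) :
    ((τ m : Fin k) : ℕ) ≠ 0 ↔ (m : ℕ) ≠ 0 := by
  by_cases hm : (m : ℕ) = 0
  · rw [hτ0 m hm]
  · rw [hτ1 m hm]; have := m.isLt; omega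

/-- `τ` is an involution. -/
theorem τ_τ (hτ0 : ∀ m : Fin k, (m : ℕ) = 0 → τ m = m)
    (hτ1 : ∀ m : Fin k, (m : ℕ) ≠ 0 → ((τ m : Fin k) : ℕ) = k - m) (m : Fin k) : τ (τ m) = m := by
  by_cases hm : (m : ℕ) = 0
  · rw [hτ0 m hm, hτ0 m hm]
  · have h1 : ((τ m : Fin k) : ℕ) ≠ 0 := (τ_ne_iff τ hτ0 hτ1 m).mpr hm
    apply Fin.ext
    rw [hτ1 _ h1, hτ1 m hm]
    have := m.isLt; omega

/-- `τ` reverses the order of non-zero indices. -/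
theorem τ_le_τ_iff (hτ1 : ∀ m : Fin k, (m : ℕ) ≠ 0 → ((τ m : Fin k) : ℕ) = k - m)
    {i j : Fin k} (hi : (i : ℕ) ≠ 0) (hj : (j : ℕ) ≠ 0) : τ j ≤ τ i ↔ i ≤ j := by
  rw [Fin.le_def, Fin.le_def, hτ1 i hi, hτ1 j hj]
  have := i.isLt; have := j.isLt; omega

/-- The condition `l + 1 + j = k` singles out `j = rev l`. -/
theorem cond_rev (l j : Fin k) : (l : ℕ) + 1 + (j : ℕ) = k ↔ j = Fin.rev l := by
  rw [Fin.ext_iff, Fin.val_rev]; have := l.isLt; omega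

/-- The condition `l + j = k` singles out `l ≠ 0` and `j = τ l`. -/
theorem cond_τ (hτ1 : ∀ m : Fin k, (m : ℕ) ≠ 0 → ((τ m : Fin k) : ℕ) = k - m) (l j : Fin k) :
    (l : ℕ) + (j : ℕ) = k ↔ (l : ℕ) ≠ 0 ∧ j = τ l := by
  constructor
  · intro h
    have hl : (l : ℕ) ≠ 0 := by intro h0; have := j.isLt; omega
    refine ⟨hl, Fin.ext ?_⟩
    rw [hτ1 l hl]; omega
  · rintro ⟨hl, rfl⟩
    rw [hτ1 l hl]; have := l.isLt; omega

/-- Collapsing an indicator sum over the condition `l + 1 + j = k`. -/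
theorem sum_ite_cond_rev {M : Type*} [AddCommMonoid M] (l : Fin k) (g : Fin k → M) :
    (∑ j : Fin k, if (l : ℕ) + 1 + (j : ℕ) = k then g j else 0) = g (Fin.rev l) := by
  simp_rw [cond_rev l]
  rw [Finset.sum_ite_eq']; simp

/-- Collapsing an indicator sum over the condition `l + j = k`. -/
theorem sum_ite_cond_τ (hτ1 : ∀ m : Fin k, (m : ℕ) ≠ 0 → ((τ m : Fin k) : ℕ) = k - m)
    {M : Type*} [AddCommMonoid M] (l : Fin k) (g : Fin k → M) :
    (∑ j : Fin k, if (l : ℕ) + (j : ℕ) = k then g j else 0) =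
      if (l : ℕ) = 0 then 0 else g (τ l) := by
  simp_rw [cond_τ τ hτ1 l]
  by_cases hl : (l : ℕ) = 0
  · rw [if_pos hl]
    exact Finset.sum_eq_zero fun j _ => if_neg fun h => h.1 hl
  · rw [if_neg hl]
    have : ∀ j : Fin k, ((l : ℕ) ≠ 0 ∧ j = τ l) ↔ j = τ l := fun j => ⟨fun h => h.2, fun h => ⟨hl, h⟩⟩
    simp_rw [this]
    rw [Finset.sum_ite_eq']; simp

/-! ### The Jacobian `∏ⱼ xⱼ^{k-1-j}` as a product of partial products -/

/-- `∏_{i ≠ 0} T i x = ∏ⱼ xⱼ^{k-1-j}` (double counting). -/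
theorem prod_T_eq_prod_pow
    (hT : ∀ (m : ℕ) (x : Fin k → ℝ), T m x = ∏ j : Fin k, if (j : ℕ) < m then x j else 1)
    (x : Fin k → ℝ) :
    (∏ i : Fin k, if (i : ℕ) = 0 then 1 else T i x) = ∏ j : Fin k, x j ^ (k - 1 - (j : ℕ)) := by
  have h1 : ∀ i : Fin k, (if (i : ℕ) = 0 then (1 : ℝ) else T i x) =
      ∏ j : Fin k, if (j : ℕ) < i then x j else 1 := by
    intro i
    split_ifs with hi
    · exact (Finset.prod_eq_one fun j _ => if_neg (by omega)).symm
    · exact hT i x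
  simp_rw [h1]
  rw [Finset.prod_comm]
  refine Finset.prod_congr rfl fun j _ => ?_
  rw [Finset.prod_ite, Finset.prod_const_one, mul_one, Finset.prod_const]
  congr 1
  have : (Finset.univ.filter fun i : Fin k => (j : ℕ) < i) = Finset.Ioi j := by
    ext i
    simp only [Finset.mem_filter, Finset.mem_univ, true_and, Finset.mem_Ioi, Fin.lt_def]
  rw [this, Fin.card_Ioi]

/-- Logarithm of the Jacobian in power form: `Σ (k-1-j) log xⱼ`. -/
theorem log_prod_pow {x : Fin k → ℝ} (hx : ∀ i, x i ∈ Set.Ioo (0 : ℝ) 1) :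
    Real.log (∏ j : Fin k, x j ^ (k - 1 - (j : ℕ))) =
      ∑ j : Fin k, ((k : ℝ) - 1 - (j : ℕ)) * Real.log (x j) := by
  rw [Real.log_prod (fun j _ => pow_ne_zero _ (hx j).1.ne')]
  refine Finset.sum_congr rfl fun j _ => ?_
  rw [Real.log_pow]
  congr 1
  have := j.isLt
  rw [Nat.cast_sub (by omega), Nat.cast_sub (by omega)]
  simp

/-- Logarithm of the Jacobian in partial-product form: `Σ_{i ≠ 0} log T i x`. -/
theorem log_prod_pow'
    (hT : ∀ (m : ℕ) (x : Fin k → ℝ), T m x = ∏ j : Fin k, if (j : ℕ) < m then x j else 1)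
    {x : Fin k → ℝ} (hx : ∀ i, x i ∈ Set.Ioo (0 : ℝ) 1) :
    Real.log (∏ j : Fin k, x j ^ (k - 1 - (j : ℕ))) =
      ∑ i : Fin k, if (i : ℕ) = 0 then 0 else Real.log (T i x) := by
  rw [← prod_T_eq_prod_pow T hT, Real.log_prod]
  · refine Finset.sum_congr rfl fun i _ => ?_
    split_ifs
    · exact Real.log_one
    · rfl
  · intro i _
    split_ifs
    · exact one_ne_zero
    · exact (T_pos T hT hx i).ne'

/-! ### The reflected point: consequences of `T m z = 1 - T (k+1-m) y` -/

/-- Coordinates of the reflected point: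
`log zᵢ = log (1 - T (k-i) y) - [i ≠ 0] log (1 - T (k+1-i) y)`. -/
theorem log_z (hT : ∀ (m : ℕ) (x : Fin k → ℝ), T m x = ∏ j : Fin k, if (j : ℕ) < m then x j else 1)
    {y z : Fin k → ℝ} (hy : ∀ i, y i ∈ Set.Ioo (0 : ℝ) 1) (hz : ∀ i, z i ∈ Set.Ioo (0 : ℝ) 1)
    (hTz : ∀ m : ℕ, 1 ≤ m → m ≤ k → T m z = 1 - T (k + 1 - m) y) (i : Fin k) :
    Real.log (z i) = Real.log (1 - T (k - i) y) -
      (if (i : ℕ) = 0 then 0 else Real.log (1 - T (k + 1 - i) y)) := by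
  have hik := i.isLt
  have h1 : T ((i : ℕ) + 1) z = T i z * z i := T_succ_eq_mul T hT z i
  have h2 : T ((i : ℕ) + 1) z = 1 - T (k - i) y := by
    rw [hTz _ (by omega) (by omega)]; congr 2; omega
  have hzi : z i = T ((i : ℕ) + 1) z / T i z := by
    rw [h1, mul_div_cancel_left₀ _ (T_pos T hT hz i).ne']
  rw [hzi, Real.log_div (by rw [h2]; exact (sub_pos.mpr (T_lt_one T hT hy (by omega)
    (by omega))).ne') (T_pos T hT hz i).ne', h2]
  congr 1
  split_ifs with hi
  · rw [hi, T_zero T hT, Real.log_one]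
  · rw [hTz _ (by omega) (by omega)]

/-- Chords of the reflected point, row `i = 0`: `log (1 - z₀⋯z_j) = log T (k-j) y`. -/
theorem log_one_sub_I_z_zero
    (hT : ∀ (m : ℕ) (x : Fin k → ℝ), T m x = ∏ j : Fin k, if (j : ℕ) < m then x j else 1)
    (hI : ∀ (i j : Fin k) (x : Fin k → ℝ), I i j x = ∏ l : Fin k, if i ≤ l ∧ l ≤ j then x l else 1)
    {y z : Fin k → ℝ} (hTz : ∀ m : ℕ, 1 ≤ m → m ≤ k → T m z = 1 - T (k + 1 - m) y)
    (i j : Fin k) (hi : (i : ℕ) = 0) (hij : i ≤ j) :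
    Real.log (1 - I i j z) = Real.log (T (k - j) y) := by
  have hjk := j.isLt
  have h1 : T ((j : ℕ) + 1) z = T i z * I i j z := T_succ_eq_mul_I T I hT hI z hij
  have h0 : T i z = 1 := by
    have : T (i : ℕ) z = T 0 z := by rw [hi]
    rw [this, T_zero T hT]
  rw [h0, one_mul, hTz _ (by omega) (by omega)] at h1
  have : I i j z = 1 - T (k - j) y := by rw [← h1]; congr 2; omega
  rw [this, sub_sub_cancel]

/-- Chords of the reflected point, rows `i ≠ 0`:
`log (1 - z_i⋯z_j) = log T (k-j) y + log (1 - y_{τ j}⋯y_{τ i}) - log (1 - T (k+1-i) y)`. -/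
theorem log_one_sub_I_z_ne
    (hT : ∀ (m : ℕ) (x : Fin k → ℝ), T m x = ∏ j : Fin k, if (j : ℕ) < m then x j else 1)
    (hI : ∀ (i j : Fin k) (x : Fin k → ℝ), I i j x = ∏ l : Fin k, if i ≤ l ∧ l ≤ j then x l else 1)
    (hτ1 : ∀ m : Fin k, (m : ℕ) ≠ 0 → ((τ m : Fin k) : ℕ) = k - m)
    {y z : Fin k → ℝ} (hy : ∀ i, y i ∈ Set.Ioo (0 : ℝ) 1) (hz : ∀ i, z i ∈ Set.Ioo (0 : ℝ) 1)
    (hTz : ∀ m : ℕ, 1 ≤ m → m ≤ k → T m z = 1 - T (k + 1 - m) y)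
    (i j : Fin k) (hi : (i : ℕ) ≠ 0) (hij : i ≤ j) :
    Real.log (1 - I i j z) = Real.log (T (k - j) y) + Real.log (1 - I (τ j) (τ i) y) -
      Real.log (1 - T (k + 1 - i) y) := by
  have hik := i.isLt; have hjk := j.isLt
  have hij' : (i : ℕ) ≤ j := hij
  have hj : (j : ℕ) ≠ 0 := by omega
  have h1 : T ((j : ℕ) + 1) z = T i z * I i j z := T_succ_eq_mul_I T I hT hI z hij
  have hTi : T i z = 1 - T (k + 1 - i) y := hTz _ (by omega) (by omega)
  have hTj : T ((j : ℕ) + 1) z = 1 - T (k - j) y := by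
    rw [hTz _ (by omega) (by omega)]; congr 2; omega
  have hTipos : 0 < T i z := T_pos T hT hz i
  have hIz : I i j z = T ((j : ℕ) + 1) z / T i z := by
    rw [h1, mul_div_cancel_left₀ _ hTipos.ne']
  have hle : τ j ≤ τ i := (τ_le_τ_iff τ hτ1 hi hj).mpr hij
  have hsplit : T (k + 1 - i) y = T (k - j) y * I (τ j) (τ i) y := by
    have := T_succ_eq_mul_I T I hT hI y hle
    rw [hτ1 i hi, hτ1 j hj] at this
    rw [← this]; congr 1; omega
  have hnum : 1 - I i j z = T (k - j) y * (1 - I (τ j) (τ i) y) / T i z := by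
    rw [hIz, hTi, hTj, mul_sub, mul_one, ← hsplit]
    have hne : (1 : ℝ) - T (k + 1 - i) y ≠ 0 :=
      (sub_pos.mpr (T_lt_one T hT hy (by omega) (by omega))).ne'
    field_simp
    ring
  rw [hnum, Real.log_div (mul_ne_zero (T_pos T hT hy _).ne'
      (sub_pos.mpr (I_lt_one I hI hy hle)).ne') hTipos.ne',
    Real.log_mul (T_pos T hT hy _).ne' (sub_pos.mpr (I_lt_one I hI hy hle)).ne', hTi]

/-! ### Registered sub-goal -/

/-- Registered sub-goal `stub_nonSimpleReductionAux1` (the Jacobian of the cubical chart by double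
counting, closed form of `prod_T_eq_prod_pow`): `∏_{i ≠ 0} (x₀⋯x_{i-1}) = ∏ⱼ xⱼ^{k-1-j}`. -/
theorem stub_nonSimpleReductionAux1 : ∀ (k : ℕ) (x : Fin k → ℝ), (∏ i : Fin k, if (i : ℕ) = 0 then (1 : ℝ) else ∏ j : Fin k, if (j : ℕ) < (i : ℕ) then x j else 1) = ∏ j : Fin k, x j ^ (k - 1 - (j : ℕ)) :=
  fun k x => prod_T_eq_prod_pow (fun (m : ℕ) (y : Fin k → ℝ) => ∏ j : Fin k, if (j : ℕ) < m then y j else 1)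
    (fun _ _ => rfl) x

end Summit.KontsevichZagierPeriods.DihedralNormalForm.TorusDescent
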